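import Literature.NumberTheory.EllipticCurves.Delbourgo2002.PAdicBSDLeadingTermIntrinsic
import HarnessLib

/-!
# Delbourgo 2002 Thm. (B): the `ℓ`-currency clauses FROM the intrinsic clauses when
# `p ∤ [E(ℚ_p) : N_∞E(ℚ_p)]` and `p ∤ c_p` (cell `bsd-addord`, seat `bsd-addord-twist`; T-ANOM (T4) glue)

HONEST FRAMING (cell `bsd-addord`, `run/shared/lean/pub/bsd-addord/README.md` §4): the programme's
target of record is the full Birch–Swinnerton-Dyer formula for every `E/ℚ` of analytic rank `≤ 1`;
nothing is booked here. Theorems only; NO named fact is minted or asserted: both clause predicates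
`Delbourgo2002.LeadingTermClauses W p Dh` (`ℓ ∣ p²`, `ℓ = 1` off the anomalous rows; file
`PAdicBSDLeadingTerm.lean`) and `Delbourgo2002.LeadingTermClausesIntrinsic W p Dh` (factor
`ι / c_p`, `ι = [E(ℚ_p) : N_∞E(ℚ_p)] = localUniversalNormIndex (v.adicCompletion ℚ) κ ⊤`, with the
printed finiteness `0 < ι`; file `PAdicBSDLeadingTermIntrinsic.lean`, p404293) are PREDICATES on a
height datum `Dh`.

## What and why

`leadingTermClauses_of_intrinsic_of_not_dvd`: if the intrinsic clauses hold for `Dh`, and at the place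
`v ∋ p` both `c_p = W.tamagawaNumberAt v` and (whenever finite) the universal-norm index `ι` are prime
to `p`, then the `ℓ`-currency clauses hold for the SAME `Dh` with **`ℓ = 1`** (the unit `u` absorbs
`ι / c_p ∈ ℤ_p^×`). Use: the cell's rank-`1` upper-half consumers
(`ClassX3Gord.missingUpperBoundAt_rankOne_of_wuthrichHalf_of_schneider_of_branchPAdicGrossZagier`, …)
are typed against `LeadingTermClauses`; on the additive potentially-good-ordinary rows of defect `2`
the hypotheses are discharged by `tamagawaNumberAt_ne_zero_and_le_four_of_addv` (`c_p ≤ 4 < p`) and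
the twist transport (T3) `UniversalNormTwist.not_dvd_localUniversalNormIndex_of_goodOrd_twist`
(`Additive/UniversalNormTwistTransportRat.lean`), anomalous or not — so the intrinsic reading of
Delbourgo's `ℓ_p(E)` (referee (α′), `REF-tanom.md`) feeds every existing `ℓ`-currency consumer.

References: D. Delbourgo, J. Number Theory 95 (2002) 38–71, Theorem (B) p. 40, p. 67 (iv), p. 69
[Delbourgo2002]; B. Mazur, Invent. Math. 18 (1972) Cor. 5.15 [Mazur1972Towers].
-/

noncomputable section

open scoped Classical NumberField

open WeierstrassCurve NumberField IsDedekindDomain Literature.NumberTheory.EllipticCurves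
  Literature.NumberTheory.EllipticCurves.Delbourgo2002

namespace Summit.BirchSwinnertonDyer.Rank1Residual.Additive

variable {W : WeierstrassCurve ℚ} {p : ℕ} [hp : Fact p.Prime]

/-- **Delbourgo (B): `ℓ`-currency clauses from the intrinsic clauses, with `ℓ = 1`, when `p ∤ ι` and
`p ∤ c_p`.** For a height datum `Dh` with `LeadingTermClausesIntrinsic W p Dh`, a place `v ∋ p` with
`p ∤ c_p = W.tamagawaNumberAt v`, and the universal-norm index `ι = [E(ℚ_p) : N_∞E(ℚ_p)]` prime to `p`
whenever it is finite (for every cyclotomic `κ`): `LeadingTermClauses W p Dh` holds, its clause 3 with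
`ℓ = 1` and the unit `u · ι · c_p⁻¹`. [cite: Delbourgo2002, Theorem (B) (p. 40) with p. 67 (iv), p. 69] -/
theorem leadingTermClauses_of_intrinsic_of_not_dvd {Dh : PAdicHeightData W p}
    (hB : LeadingTermClausesIntrinsic W p Dh) (v : HeightOneSpectrum (𝓞 ℚ))
    (hv : (p : 𝓞 ℚ) ∈ v.asIdeal) (hcp : ¬ p ∣ W.tamagawaNumberAt v)
    (hι : ∀ κ : ZpExtension ℚ p, κ.IsCyclotomic →
      localUniversalNormIndex (W := W) (v.adicCompletion ℚ) κ ⊤ ≠ 0 →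
      ¬ p ∣ localUniversalNormIndex (W := W) (v.adicCompletion ℚ) κ ⊤) :
    LeadingTermClauses W p Dh := by
  intro κ γ hκ hγ hγ' D _ hX fE hf
  obtain ⟨h1, h2, h3⟩ := hB κ γ hκ hγ hγ' D hX fE hf v hv
  refine ⟨h1, h2, fun hS hfin ↦ ?_⟩
  obtain ⟨hιpos, u, heq⟩ := h3 hS hfin
  set ι : ℕ := localUniversalNormIndex (W := W) (v.adicCompletion ℚ) κ ⊤ with hι_def
  -- `ι` and `c_p` are units of `ℤ_p` (a natural number prime to `p` is a unit; cf. the tree's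
  -- `GaloisImage.Derivative.isUnit_natCast_padicInt_of_not_dvd`, not imported here to keep the cone small)
  have hunit : ∀ n : ℕ, ¬ p ∣ n → IsUnit ((n : ℕ) : ℤ_[p]) := fun n hn ↦ by
    have hnorm : ‖((n : ℤ) : ℤ_[p])‖ = 1 := by
      refine le_antisymm (PadicInt.norm_le_one _) (not_lt.mp ?_)
      rw [PadicInt.norm_int_lt_one_iff_dvd]
      exact_mod_cast hn
    rw [← Int.cast_natCast]
    exact PadicInt.isUnit_iff.mpr hnorm
  have hιu : IsUnit ((ι : ℕ) : ℤ_[p]) := hunit ι (hι κ hκ hιpos.ne')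
  have hcu : IsUnit ((W.tamagawaNumberAt v : ℕ) : ℤ_[p]) := hunit _ hcp
  have hcp0 : ((W.tamagawaNumberAt v : ℕ) : ℚ_[p]) ≠ 0 := by
    have h0 : W.tamagawaNumberAt v ≠ 0 := fun h ↦ hcp (h ▸ dvd_zero p)
    exact_mod_cast h0
  -- the unit `u' = u · ι · c_p⁻¹`
  obtain ⟨cinv, hcinv⟩ : ∃ cinv : ℤ_[p], ((W.tamagawaNumberAt v : ℕ) : ℤ_[p]) * cinv = 1 :=
    hcu.exists_right_inv
  have hcinvu : IsUnit cinv := isUnit_iff_exists_inv.mpr ⟨_, by rw [mul_comm]; exact hcinv⟩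
  have hx : IsUnit ((u : ℤ_[p]) * (ι : ℤ_[p]) * cinv) := (u.isUnit.mul hιu).mul hcinvu
  refine ⟨hx.unit, 1, one_dvd _, fun _ ↦ rfl, ?_⟩
  have hcinvQ : ((W.tamagawaNumberAt v : ℕ) : ℚ_[p]) * ((cinv : ℤ_[p]) : ℚ_[p]) = 1 := by
    have h := congrArg ((↑) : ℤ_[p] → ℚ_[p]) hcinv
    simpa only [PadicInt.coe_mul, PadicInt.coe_natCast, PadicInt.coe_one] using h
  have hcinv' : ((cinv : ℤ_[p]) : ℚ_[p]) = ((W.tamagawaNumberAt v : ℕ) : ℚ_[p])⁻¹ :=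
    eq_inv_of_mul_eq_one_right hcinvQ
  have hR : ((hx.unit : ℤ_[p]) : ℚ_[p]) =
      ((u : ℤ_[p]) : ℚ_[p]) * ((ι : ℚ_[p]) / ((W.tamagawaNumberAt v : ℕ) : ℚ_[p])) := by
    rw [hx.unit_spec, PadicInt.coe_mul, PadicInt.coe_mul, PadicInt.coe_natCast, hcinv', div_eq_mul_inv,
      mul_assoc]
  rw [heq, hR, Nat.cast_one, mul_one]

end Summit.BirchSwinnertonDyer.Rank1Residual.Additive

end
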